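import Literature.AlgebraicGeometry.HodgeTheory.AbelianVarietyIdealTorsionCount
import Literature.AlgebraicGeometry.Motives.AbelianVarietyConjugate
import Literature.AlgebraicGeometry.Motives.AbelianVarietyTorsionPointsCountProofs
import Literature.NumberTheory.DiophantineGeometry.AVGaloisModule
import Literature.FieldTheory.AlgClosed.PadicAlgClosureEmbedsComplex
import HarnessLib

/-!
# Ideal-torsion points over ANY algebraically closed field that embeds in `ℂ` (`ℚ̄`, `F̄_w`, `#K ≤ 𝔠`):
# `#{t ∈ A(K) | θ(𝔞) t = 1} = N𝔞 ^ (2 dim A ∕ rk_ℤ 𝒪)` ([Shimura1998] §7.5 p. 72, characteristic `0`, any index)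

Topic `Literature/AlgebraicGeometry/HodgeTheory`; namespace `Literature.AlgebraicGeometry.HodgeTheory.AbelianVariety` (sequel of ★
`AbelianVarietyIdealTorsionCount`, the count over `ℂ`).  THEOREMS ONLY (no definition, no named fact, no `instance`, no notation, no `sorry`).
Cell `hodgecm-mathlib` (D-0151), FLOOR 0, P6 «MOD programme» (crux hLiu418 = stmt-HodgeConjecture-24832, `--supports`, count-neutral): organ
**(LAT-B) «IDEAL-TORSION COUNT OVER THE GENERIC GEOMETRIC FIELD»** of the GENERIC-FIBRE road (LDEAL v1 §L1 T2: «the characteristic-0 `𝒪⧸𝔭`-module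
structure of `A_K[𝔭](K̄)`, rank `N𝔭^{2g∕[F:ℚ]}`»): the «`ℂ ↔ Ω̄`» transport of the H4 census (line L3, item (2)), i.e. the passage from the complex
count ★ `natCard_idealTorsion_eq_absNorm_pow` to the algebraically closed field over which the generic geometric point of the moduli datum lives
(`F̄_w = AlgebraicClosure (w.adicCompletion F)`, ★ `PadicAlgClosureEmbedsComplex`).  HC_CM is proved only modulo the printed citations
(2 remaining named inputs hLiu418 24832, h413 24833) until rung 0 closes; this file is generic and changes no count.

THE MATHEMATICS ([Milne2005ShimuraVarieties] §11 p. 108 «a homomorphism `σ : k → Ω` of fields defines a functor `V ↦ σV` … `σ(A, i) = (σA, σi)` …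
a point `P ∈ A(k)` gives a point `σP ∈ σA(Ω)` … provided that `k` and `Ω` are algebraically closed»; [MumfordAV1970] §6 Prop. p. 64: `#A[n](k) = n^{2g}`
for every algebraically closed `k` of characteristic prime to `n`).  Let `σ : K → ℂ` be a ring homomorphism, `A ∕ K` an abelian variety,
`θ : 𝒪 → End A` with `𝒪` a Dedekind domain finite free over `ℤ`.  The map `t ↦ σt : A(K) → (σA)(ℂ)` (★ `AlgPoints.extendScalars` to the
`K`-algebra `ℂ_σ`, then ★ `pointsAlong`) is an injective group homomorphism with `σ(θ(a) t) = (σθ)(a)(σt)` (§1); when `K` is algebraically closed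
it is ONTO the torsion of `σA` (both `A[n](K)` and `(σA)[n](ℂ)` have `n^{2 dim A}` elements, ★ `natCard_torsionPoints_eq_of_isAlgClosed`), and the
`θ(𝔞)`-torsion lies in the `N𝔞`-torsion (`θ(N) = N_A`).  Hence `t ↦ σt` is a bijection `{t ∈ A(K) | θ(𝔞)t = 1} ≃ {t′ ∈ σA(ℂ) | σθ(𝔞)t′ = 1}`
and the complex count ★ `natCard_idealTorsion_eq_absNorm_pow` (with `dim σA = dim A`) gives **`#{t ∈ A(K) | θ(𝔞)t = 1} = N𝔞 ^ (2 dim A ∕ rk_ℤ 𝒪)`**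
(§2); `rk_ℤ 𝒪 ∣ 2 dim A` for ANY `K` with a homomorphism to `ℂ` (§2).  §3: every algebraically closed `K` of characteristic `0` with `#K ≤ 𝔠`
(★ `nonempty_ringHom_complex_of_cardinalMk_le_continuum`), in particular `F̄_w` (★ `nonempty_ringHom_algebraicClosure_adicCompletion_complex`).

## Contents
* §1 `map_extendScalars_alongHom`, `pointsAlong_extendScalars_injective` ∕ `_mul` ∕ `_one`, **`pointsAlong_extendScalars_monoidHom`**
  (`σ(f t) = (σf)(σt)`), **`exists_extendScalars_alongHom_eq_of_pow_eq_one`** (torsion does not grow from `K = K̄` to `ℂ`).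
* §2 **`finrank_int_dvd_two_mul_dim_of_ringHom_complex`**, **`natCard_idealTorsion_eq_absNorm_pow_of_ringHom_complex`**.
* §3 **`natCard_idealTorsion_eq_absNorm_pow_of_cardinalMk_le_continuum`**, **`natCard_idealTorsion_eq_absNorm_pow_algebraicClosure_adicCompletion`**.

## References
* [Shimura1998] G. Shimura, *Abelian Varieties with Complex Multiplication and Modular Functions* (1998), §7.5 p. 72 L1–L3 ("if `𝔞` is prime to
  the characteristic … `𝔤(𝔞, A)` is of order `N(𝔞)^m`").
* [Milne2005ShimuraVarieties] J. S. Milne, *Introduction to Shimura varieties* (2005), §11 p. 108 (the functor `σ`, `σP ∈ σA(Ω)`).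
* [MumfordAV1970] D. Mumford, *Abelian Varieties* (1970), §6 Application 3 ∕ Proposition p. 64 (`A[n](k) ≅ (ℤ∕n)^{2g}`).
-/

set_option autoImplicit false

noncomputable section

open Module CategoryTheory Function AlgebraicGeometry
open scoped MonObj Cardinal

universe u

namespace Literature.AlgebraicGeometry.HodgeTheory.AbelianVariety

open Literature.AlgebraicGeometry.Motives Literature.AlgebraicGeometry.Motives.AbelianVariety

variable {K : Type} [Field K] (σ : K →+* ℂ) {A : Motives.AbelianVariety K}

/-! ## §1 Transport of points along `σ : K → ℂ`: `t ↦ σt ∈ (σA)(ℂ)` -/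

/-- Extension of scalars of points commutes with homomorphisms: `f(t)_{ℂ_σ} = f(t_{ℂ_σ})` (both are composites in `SchemeOver K`).
[cite: Milne2005ShimuraVarieties, §11 p. 108 (the functor `σ`)] -/
theorem map_extendScalars_alongHom {B : Motives.AbelianVariety K} (f : A ⟶ B) (t : A.Points K) :
    AlgPoints.map f.hom.hom.hom (AlgPoints.extendScalars A.X K (AlongHom ℂ σ) t) =
      AlgPoints.extendScalars B.X K (AlongHom ℂ σ) (AlgPoints.map f.hom.hom.hom t) := by
  rw [AlgPoints.extendScalars_apply, AlgPoints.extendScalars_apply, AlgPoints.map_apply, AlgPoints.map_apply,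
    Category.assoc]

/-- `t ↦ σt : A(K) → (σA)(ℂ)` is injective (★ `extendScalars_injective`, ★ `pointsAlong` bijective). [cite: Milne2005ShimuraVarieties, §11 p. 108 («σP ∈ σA(Ω)»)] -/
theorem pointsAlong_extendScalars_injective :
    Injective fun t : A.Points K => A.pointsAlong σ (AlgPoints.extendScalars A.X K (AlongHom ℂ σ) t) := fun _ _ h =>
  AlgPoints.extendScalars_injective A.X (L := K) (L' := AlongHom ℂ σ) ((A.pointsAlong σ).injective h)

/-- `t ↦ σt` is multiplicative (a composite of the monoid homomorphisms ★ `extendScalarsMonoidHom` and ★ `pointsAlong`).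
[cite: Milne2005ShimuraVarieties, §11 p. 108 («σP ∈ σA(Ω)»)] -/
theorem pointsAlong_extendScalars_mul (t t' : A.Points K) :
    A.pointsAlong σ (AlgPoints.extendScalars A.X K (AlongHom ℂ σ) (t * t')) =
      A.pointsAlong σ (AlgPoints.extendScalars A.X K (AlongHom ℂ σ) t) *
        A.pointsAlong σ (AlgPoints.extendScalars A.X K (AlongHom ℂ σ) t') := by
  rw [AlgPoints.extendScalars_mul, map_mul]

/-- `t ↦ σt` sends `1` to `1`. [cite: Milne2005ShimuraVarieties, §11 p. 108 («σP ∈ σA(Ω)»)] -/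
theorem pointsAlong_extendScalars_one :
    A.pointsAlong σ (AlgPoints.extendScalars A.X K (AlongHom ℂ σ) (1 : A.Points K)) = 1 := by
  rw [AlgPoints.extendScalars_one, map_one]

/-- **Equivariance `σ(f t) = (σf)(σt)`** for a homomorphism `f : A → B` (Milne's `σ(A, i) = (σA, σi)`; ★ `pointsAlong_map`).
[cite: Milne2005ShimuraVarieties, §11 p. 108 («σi(a) = σ(i(a))»)] -/
theorem pointsAlong_extendScalars_monoidHom {B : Motives.AbelianVariety K} (f : A ⟶ B) (t : A.Points K) :
    B.pointsAlong σ (AlgPoints.extendScalars B.X K (AlongHom ℂ σ) (IsMonHom.monoidHom f.hom.hom.hom (specOver K K) t)) =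
      IsMonHom.monoidHom (Hom.baseChangeAlong σ f).hom.hom.hom (specOver ℂ ℂ)
        (A.pointsAlong σ (AlgPoints.extendScalars A.X K (AlongHom ℂ σ) t)) := by
  rw [IsMonHom.monoidHom_apply, ← AlgPoints.map_apply, IsMonHom.monoidHom_apply, ← AlgPoints.map_apply,
    ← map_extendScalars_alongHom, pointsAlong_map]

/-- **Torsion does not grow from `K = K̄` to `ℂ`**: for `K` algebraically closed (with `σ : K → ℂ`, so of characteristic `0`) and `n ≠ 0`, every
`n`-torsion point of `A` with values in the `K`-algebra `ℂ_σ` is the extension of an `n`-torsion `K`-point — `A[n](K) ↪ A[n](ℂ_σ)` injects between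
finite sets of the same size `n^{2 dim A}` (★ `natCard_torsionPoints_eq_of_isAlgClosed`; the tree's `exists_extendScalars_eq_of_pow_eq_one` is the
case `K = ℂ`). [cite: MumfordAV1970, §6 Proposition p. 64] -/
theorem exists_extendScalars_alongHom_eq_of_pow_eq_one [IsAlgClosed K] {n : ℕ} (hn : n ≠ 0)
    {b : A.Points (AlongHom ℂ σ)} (hb : b ^ n = 1) :
    ∃ a : A.Points K, AlgPoints.extendScalars A.X K (AlongHom ℂ σ) a = b := by
  haveI : CharZero K := σ.charZero
  haveI : IsAlgClosed (AlongHom ℂ σ) := inferInstanceAs (IsAlgClosed ℂ)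
  have hnz : ((n : ℤ) : K) ≠ 0 := by exact_mod_cast hn
  let f : A.torsionPoints K (n : ℤ) → A.torsionPoints (AlongHom ℂ σ) (n : ℤ) := fun a =>
    ⟨AlgPoints.extendScalars A.X K (AlongHom ℂ σ) a.1, by
      rw [AbelianVariety.mem_torsionPoints_iff, ← AlgPoints.extendScalarsMonoidHom_apply, ← map_zpow,
        (A.mem_torsionPoints_iff _ _).1 a.2, map_one]⟩
  have hf : Injective f := fun a a' h =>
    Subtype.ext (AlgPoints.extendScalars_injective A.X (L := K) (L' := AlongHom ℂ σ) (congrArg Subtype.val h))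
  haveI : Finite (A.torsionPoints (AlongHom ℂ σ) (n : ℤ)) := by
    apply Nat.finite_of_card_ne_zero
    rw [A.natCard_torsionPoints_eq_of_isAlgClosed (AlongHom ℂ σ) n hnz]
    exact pow_ne_zero _ (by exact_mod_cast hn)
  have hcard : Nat.card (A.torsionPoints (AlongHom ℂ σ) (n : ℤ)) ≤ Nat.card (A.torsionPoints K (n : ℤ)) := by
    rw [A.natCard_torsionPoints_eq_of_isAlgClosed (AlongHom ℂ σ) n hnz, A.natCard_torsionPoints_eq_of_isAlgClosed K n hnz]
  obtain ⟨a, ha⟩ := (hf.bijective_of_nat_card_le hcard).2 ⟨b, by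
    rw [AbelianVariety.mem_torsionPoints_iff, zpow_natCast]; exact hb⟩
  exact ⟨a.1, congrArg Subtype.val ha⟩

/-! ## §2 The count over an algebraically closed field with a ring homomorphism into `ℂ` -/

variable {O : Type u} [CommRing O] [IsDedekindDomain O] [Module.Free ℤ O] [Module.Finite ℤ O]

/-- **`rk_ℤ 𝒪 ∣ 2 dim A`** for an abelian variety `A` over any field `K` admitting a ring homomorphism `σ : K → ℂ`, with
`θ : 𝒪 → End A` (`𝒪` Dedekind, finite free over `ℤ`): apply ★ `finrank_int_dvd_two_mul_dim` to `σA` and `σθ` (`dim σA = dim A`).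
[cite: Shimura1998, §7.1 (1)] -/
theorem finrank_int_dvd_two_mul_dim_of_ringHom_complex (σ : K →+* ℂ) (θ : O →+* End A) : finrank ℤ O ∣ 2 * A.dim := by
  rw [← dim_baseChangeAlong σ A]
  exact finrank_int_dvd_two_mul_dim ((A.endBaseChangeAlong σ).comp θ)

/-- **`#{t ∈ A(K) | θ(𝔞) t = 1} = N𝔞 ^ (2 dim A ∕ rk_ℤ 𝒪)`** for an abelian variety `A` over an ALGEBRAICALLY CLOSED field `K` admitting a ring
homomorphism `σ : K → ℂ` (`ℚ̄`, `ℂ`, `F̄_w`, … — any algebraically closed field of characteristic `0` and cardinality `≤ 𝔠`), `θ : 𝒪 → End A`,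
`𝒪` a Dedekind domain finite free over `ℤ`, `𝔞 ≠ 0`: transport along `t ↦ σt ∈ (σA)(ℂ)` (injective, equivariant, onto the torsion) and ★
`natCard_idealTorsion_eq_absNorm_pow` over `ℂ`. [cite: Shimura1998, §7.5 p. 72 ("`𝔤(𝔞, A)` is of order `N(𝔞)^m`")] -/
theorem natCard_idealTorsion_eq_absNorm_pow_of_ringHom_complex [IsAlgClosed K] (σ : K →+* ℂ) (θ : O →+* End A) (𝔞 : Ideal O)
    (h𝔞 : 𝔞 ≠ ⊥) :
    Nat.card {t : A.Points K // ∀ a ∈ 𝔞, IsMonHom.monoidHom (θ a).hom.hom.hom (specOver K K) t = 1} =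
      Ideal.absNorm 𝔞 ^ (2 * A.dim / finrank ℤ O) := by
  set θ' : O →+* End (A.baseChangeAlong σ) := (A.endBaseChangeAlong σ).comp θ with hθ'
  rw [← dim_baseChangeAlong σ A, ← natCard_idealTorsion_eq_absNorm_pow θ' 𝔞 h𝔞]
  -- the transport `E : t ↦ σt`
  set E : A.Points K → (A.baseChangeAlong σ).Points ℂ :=
    fun t => A.pointsAlong σ (AlgPoints.extendScalars A.X K (AlongHom ℂ σ) t) with hE
  have hEθ : ∀ (a : O) (t : A.Points K), E (IsMonHom.monoidHom (θ a).hom.hom.hom (specOver K K) t) =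
      IsMonHom.monoidHom (θ' a).hom.hom.hom (specOver ℂ ℂ) (E t) := fun a t =>
    pointsAlong_extendScalars_monoidHom σ (θ a) t
  have hE1 : E 1 = 1 := pointsAlong_extendScalars_one σ
  have hEinj : Injective E := pointsAlong_extendScalars_injective σ
  -- a natural number `N ≠ 0` in `𝔞`; `θ'(N)` acts as `t ↦ t ^ N`
  set N : ℕ := Ideal.absNorm 𝔞 with hN
  have hN0 : N ≠ 0 := by rw [hN, Ne, Ideal.absNorm_eq_zero_iff]; exact h𝔞
  have hNmem : ((N : ℕ) : O) ∈ 𝔞 := Ideal.absNorm_mem 𝔞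
  refine Nat.card_congr (Equiv.ofBijective (fun t => ⟨E t.1, fun a ha => ?_⟩) ⟨fun t₁ t₂ h => ?_, fun t' => ?_⟩)
  · rw [← hEθ, t.2 a ha, hE1]
  · exact Subtype.ext (hEinj (congrArg Subtype.val h))
  · -- `t'` is `N`-torsion, hence `σ` of a `K`-point
    have h1 : (t'.1 : (A.baseChangeAlong σ).Points ℂ) ^ N = 1 := by
      rw [← monoidHom_map_natCast_apply θ' N t'.1]; exact t'.2 _ hNmem
    obtain ⟨b, hb⟩ := (A.pointsAlong σ).surjective t'.1
    have hbN : b ^ N = 1 := by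
      apply (A.pointsAlong σ).injective
      rw [map_pow, hb, h1, map_one]
    obtain ⟨a, ha⟩ := exists_extendScalars_alongHom_eq_of_pow_eq_one σ hN0 hbN
    have hEa : E a = t'.1 := by rw [hE]; dsimp only; rw [ha, hb]
    refine ⟨⟨a, fun x hx => hEinj ?_⟩, Subtype.ext hEa⟩
    rw [hEθ, hEa, t'.2 x hx, hE1]

/-! ## §3 Instances: `#K ≤ 𝔠`, and `K = F̄_w` -/

/-- **The count over any algebraically closed field `K` of characteristic `0` with `#K ≤ 𝔠`** (such a `K` embeds into `ℂ`, ★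
`nonempty_ringHom_complex_of_cardinalMk_le_continuum`). [cite: Shimura1998, §7.5 p. 72 ("`𝔤(𝔞, A)` is of order `N(𝔞)^m`")] -/
theorem natCard_idealTorsion_eq_absNorm_pow_of_cardinalMk_le_continuum [IsAlgClosed K] [CharZero K] (hK : #K ≤ 𝔠)
    (θ : O →+* End A) (𝔞 : Ideal O) (h𝔞 : 𝔞 ≠ ⊥) :
    Nat.card {t : A.Points K // ∀ a ∈ 𝔞, IsMonHom.monoidHom (θ a).hom.hom.hom (specOver K K) t = 1} =
      Ideal.absNorm 𝔞 ^ (2 * A.dim / finrank ℤ O) := by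
  obtain ⟨τ⟩ := Literature.FieldTheory.AlgClosed.nonempty_ringHom_complex_of_cardinalMk_le_continuum K hK
  exact natCard_idealTorsion_eq_absNorm_pow_of_ringHom_complex τ θ 𝔞 h𝔞

end Literature.AlgebraicGeometry.HodgeTheory.AbelianVariety

/-! ### The generic geometric fibre of the `P6` programme: `K = F̄_w` -/

namespace Literature.AlgebraicGeometry.HodgeTheory.AbelianVariety

open Literature.AlgebraicGeometry.Motives Literature.AlgebraicGeometry.Motives.AbelianVariety
open IsDedekindDomain NumberField

variable {O : Type u} [CommRing O] [IsDedekindDomain O] [Module.Free ℤ O] [Module.Finite ℤ O]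

/-- **The count over `F̄_w = AlgebraicClosure (w.adicCompletion F)`** (`F` a number field, `w` a finite place; `F̄_w →+* ℂ` exists, ★
`nonempty_ringHom_algebraicClosure_adicCompletion_complex`): for an abelian variety `A ∕ F̄_w` with `θ : 𝒪 → End A`,
`#{t ∈ A(F̄_w) | θ(𝔞) t = 1} = N𝔞 ^ (2 dim A ∕ rk_ℤ 𝒪)`. [cite: Shimura1998, §7.5 p. 72 ("`𝔤(𝔞, A)` is of order `N(𝔞)^m`")] -/
theorem natCard_idealTorsion_eq_absNorm_pow_algebraicClosure_adicCompletion (F : Type) [Field F] [NumberField F]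
    (w : HeightOneSpectrum (𝓞 F)) {A : Motives.AbelianVariety (AlgebraicClosure (w.adicCompletion F))}
    (θ : O →+* End A) (𝔞 : Ideal O) (h𝔞 : 𝔞 ≠ ⊥) :
    Nat.card {t : A.Points (AlgebraicClosure (w.adicCompletion F)) //
        ∀ a ∈ 𝔞, IsMonHom.monoidHom (θ a).hom.hom.hom (specOver _ _) t = 1} =
      Ideal.absNorm 𝔞 ^ (2 * A.dim / finrank ℤ O) := by
  obtain ⟨τ⟩ := Literature.FieldTheory.AlgClosed.nonempty_ringHom_algebraicClosure_adicCompletion_complex F w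
  exact natCard_idealTorsion_eq_absNorm_pow_of_ringHom_complex τ θ 𝔞 h𝔞

end Literature.AlgebraicGeometry.HodgeTheory.AbelianVariety

end
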